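import Summits.PneNP.PneNP.Theses.Mobius
import Literature.Computability.QuantumComplexity.LiouvilleFactoringOracle

/-!
# Route Mobius — `ImpliesFactoringNotInP` (stmt-PneNP-1116)

`LiouvilleNotInP → ¬ FactInP`: the contrapositive of the proved tree theorem
`Literature.Computability.QuantumComplexity.LiouvilleOracle.liouvillePos_mem_P_of_FACT_mem_P`
(`FACT ∈ P → bin {N : λ(N) = 1} ∈ P`: `λ` is read off the factorisation found by binary search with the bounded-divisor
oracle, and `P^P = P`).
-/

set_option linter.dupNamespace false -- `Summit.PneNP.PneNP.…`: summit = sub-problem name (D-0017 single-conjunct layout)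

namespace Summit.PneNP.PneNP.Theorems

/-- **Support item `ImpliesFactoringNotInP` of route Mobius (stmt-PneNP-1116)**: if `bin {N : λ(N) = 1} ∉ P` then
factoring (the bounded-divisor language `FACT`) is not in `P` — contrapositive of
`liouvillePos_mem_P_of_FACT_mem_P`. [cite: AroraBarakCC2009, Example 2.3] -/
theorem mobius_impliesFactoringNotInP_proof : Summit.PneNP.PneNP.Theses.Mobius.ImpliesFactoringNotInP :=
  fun hL hF => hL (Literature.Computability.QuantumComplexity.LiouvilleOracle.liouvillePos_mem_P_of_FACT_mem_P hF)

end Summit.PneNP.PneNP.Theorems
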